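import Summits.BirchSwinnertonDyer.BirchSwinnertonDyer.Theorems.GenusKolyvaginAtTwoEquivariantKolyvaginExactAtTwoKolyvaginPrimeDictionary
import Literature.NumberTheory.GaloisRepresentations.IntegralGaloisAction
import HarnessLib

/-!
# Route `GenusKolyvaginAtTwo`, LINE 6, KEY crux Q3 (inner statement of stmt-BirchSwinnertonDyer-22137):
# the Selmer local condition descends `K → ℚ` at a RAMIFIED prime `v ∣ d_K` of good reduction, away from the
# DEF locus — McCallum's Lemma 4.3 over `ℚ` at the primes of `d_K` for the member `E`, on the DEF-free habitat

Helper (seat `bsd-line-gk2-p3` g12; `--supports` the crux, closes nothing). This lineage's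
`…SelmerDescentUnramified` / `…SelmerDescentQuadratic` transfer the Selmer condition of a class `x ∈ H¹(ℚ, E[n])`
from `res x ∈ H¹(K, E_K[n])` down to `ℚ` at the good places `v ∤ n` UNRAMIFIED in `K`. At a prime `v ∣ d_K`
(ramified in `K = ℚ(√d_K)`, `E` good at `v`, `v ∤ n`) the transfer can fail: the obstruction is the value
`t = φ(σ) ∈ E[n]` of a cocycle of `x` at an inertia element `σ ∈ I_𝔓 ∖ res Γ_K` — the "DEF symbol" of the crux's
memo Q3-RAT-LOCAL (§4, §6; evidence #31). This file proves the two constraints on `t` and the resulting transfer: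

* §1 `φ(σ) ∈ E[n]` is killed by `2` and fixed by the whole decomposition group `D_𝔓` (for ANY extension `L/F` of
  number fields whose restriction image `res Γ_L ≤ Γ_F` has "index ≤ 2" — a product of two non-members is a member
  — and is normal; any elliptic `E/F` good at `v ∤ n`; `𝔔 ∣ w ∣ v`, `𝔓 = 𝔔 ∩ \bar ℤ_F`): the restriction of a
  cocycle to `I_𝔓` is a `D_𝔓`-equivariant homomorphism (inertia acts trivially on `E[n]`, AEC VII.4.1), it
  vanishes on `I_𝔓 ∩ res Γ_L = res I_𝔔` when `res x` is unramified at `𝔔`, and `σ² , gσg⁻¹σ⁻¹ ∈ res Γ_L`;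
* §1 main: `mem_selmerLocalKer_of_resTorsion_mem_of_fixed_two_torsion_eq_zero` — **if no non-zero point of
  `E[n]` killed by `2` is fixed by `D_𝔓`, then `res x ∈ selmerLocalKer_w(E_L) ⟹ x ∈ selmerLocalKer_v(E)`**, at
  every good `v ∤ n`, ramified or not;
* §2 over `ℚ` with `K = ℚ(θ)`, `θ² = c`: the two group-theoretic hypotheses hold
  (`exists_embed_range_absGaloisRestrict_iff`, `mul_mem_range_absGaloisRestrict_of_not_mem`,
  `conj_mem_range_absGaloisRestrict`: every `g ∈ Γ_ℚ` moves `e(θ)` to `±e(θ)`), whence `mem_selmerLocalKer_of_resTorsion_mem_quadratic_of_fixed_two_torsion_eq_zero`.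

Reading for the crux (pair descent at `2` over `ℚ`, `n = 2^M`, member `E`, `v ∣ d_K`): the hypothesis "no
`D_𝔓`-fixed point of order `2`" is `E(ℚ_v)[2] = 0`, i.e. `Frob_v` acts on `E[2]` as a `3`-cycle (`a_v(E)` odd) —
the DEF-FREE primes of the memo; there Lemma 4.3 over `ℚ` follows from Lemma 4.3 over `K`. At a DEF prime
(`Frob_v` a transposition) the hypothesis fails and `t ∈ E(ℚ_v)[2] ≅ ℤ/2` is a genuine invariant of the class.
THEOREMS ONLY (no definition, no named fact, no `sorry`, standard axioms). BSD is not proved by any of this.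

References: [McCallumLMS1991] §4 Lemma 4.3; [GrossLMS1991] Prop. 6.2 (1), §7 (7.1), (7.4); [SilvermanAEC2009]
Prop. VII.4.1, Cor. X.4.4; [NeukirchANT1999] I §9 (9.4)–(9.6); [SerreGaloisCohomology1997] I §2.6, §5.8;
[Kolyvagin1989Izv] §3 (the pair `(E, E^D)`, l = 2).
-/

set_option autoImplicit false
set_option linter.dupNamespace false -- tree convention: `Summit.BirchSwinnertonDyer.BirchSwinnertonDyer.Theorems` (summit = sub-problem)

noncomputable section

open scoped Classical Pointwise

universe u

namespace Summit.BirchSwinnertonDyer.BirchSwinnertonDyer.Theorems.GenusExact.SelmerDescent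

open WeierstrassCurve NumberField IsDedekindDomain Field
open Literature.NumberTheory.EllipticCurves Literature.NumberTheory.GaloisRepresentations

/-! ## §1 Any `L/F` with `res Γ_L` normal of index `≤ 2`: the transfer away from fixed `2`-torsion -/

section General

variable {F : Type u} [Field F] [NumberField F] (W : WeierstrassCurve F) [W.IsElliptic]
variable (L : Type u) [Field L] [NumberField L] [Algebra F L]
variable (v : HeightOneSpectrum (𝓞 F)) (w : HeightOneSpectrum (𝓞 L)) [w.asIdeal.LiesOver v.asIdeal]

omit [NumberField F] [W.IsElliptic] in
/-- `I_𝔓` is normalised by `D_𝔓`: `g σ g⁻¹ ∈ I_𝔓` for `g ∈ D_𝔓`, `σ ∈ I_𝔓`. [cite: NeukirchANT1999, Ch. I §9 (9.4)–(9.6)] -/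
theorem conj_mem_inertia {A : Type*} [Ring A] {G : Type*} [Group G] [MulSemiringAction G A] {𝔓 : Ideal A}
    {g σ : G} (hg : g ∈ 𝔓.decompositionSubgroup G) (hσ : σ ∈ 𝔓.inertia G) : g * σ * g⁻¹ ∈ 𝔓.inertia G := by
  rw [AddSubgroup.mem_inertia] at hσ ⊢
  intro x
  have h1 : (g * σ * g⁻¹) • x - x = g • (σ • (g⁻¹ • x) - g⁻¹ • x) := by
    rw [smul_sub, mul_smul, mul_smul, smul_inv_smul]
  rw [h1, Submodule.mem_toAddSubgroup]
  have h2 : σ • (g⁻¹ • x) - g⁻¹ • x ∈ 𝔓 := hσ (g⁻¹ • x)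
  have hg' : g • 𝔓 = 𝔓 := (Ideal.mem_decompositionSubgroup_iff).mp hg
  rw [← hg']
  exact Ideal.smul_mem_pointwise_smul_iff.mpr h2

/-- **The Selmer condition descends along `L/F` at a good place `v ∤ n`, ramified or not, away from
`D_𝔓`-fixed `2`-torsion.** Let `E = W/F` be elliptic, `n : ℤ`, `v` of good reduction with `v ∤ n`, `w ∣ v`, `𝔔` a
prime of `\bar ℤ_L` above `w`, `𝔓 = 𝔔 ∩ \bar ℤ_F`. Suppose the restriction image `H = res Γ_L ≤ Γ_F` satisfies:
a product of two elements outside `H` lies in `H`, and `H` is normal ("`[Γ_F : H] ≤ 2`", e.g. `L/F` quadratic);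
and suppose NO non-zero `T ∈ E[n]` with `2T = 0` is fixed by the decomposition group `D_𝔓`. Then for
`x ∈ H¹(F, E[n])`: if `res x` satisfies the Selmer condition of `E_L` at `w`, `x` satisfies the Selmer condition of
`E` at `v`. Proof: both conditions are "unramified" (`selmerLocalKer_eq_unramifiedKer`); a cocycle `φ` of `x` is a
`D_𝔓`-equivariant homomorphism on `I_𝔓` (trivial action), zero on `res I_𝔔 = I_𝔓 ∩ H`; `σ² ∈ H` and
`gσg⁻¹σ⁻¹ ∈ H` give `2φ(σ) = 0` and `g φ(σ) = φ(σ)`, so `φ(σ) = 0`. [cite: McCallumLMS1991, §4 Lemma 4.3]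
[cite: GrossLMS1991, §7 (7.1) and (7.4)] [cite: SerreGaloisCohomology1997, I §5.8] -/
theorem mem_selmerLocalKer_of_resTorsion_mem_of_fixed_two_torsion_eq_zero (n : ℤ)
    (hgood : W.HasGoodReductionAt v) (hn : (n : 𝓞 F) ∉ v.asIdeal)
    {𝔔 : Ideal (absIntegers (𝓞 L) L)} (h𝔔 : 𝔔 ∈ w.primesAbove)
    (hmul : ∀ a b : absoluteGaloisGroup F, a ∉ (absGaloisRestrict F L).toMonoidHom.range →
      b ∉ (absGaloisRestrict F L).toMonoidHom.range → a * b ∈ (absGaloisRestrict F L).toMonoidHom.range)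
    (hconj : ∀ g h : absoluteGaloisGroup F, h ∈ (absGaloisRestrict F L).toMonoidHom.range →
      g * h * g⁻¹ ∈ (absGaloisRestrict F L).toMonoidHom.range)
    (hfix : ∀ T : geomTorsion W n, 2 • T = 0 →
      (∀ g ∈ (𝔔.comap (absIntegersMap F L)).decompositionSubgroup (absoluteGaloisGroup F), g • T = T) → T = 0)
    {x : galH1Torsion W n}
    (hx : resTorsion W L n x ∈ selmerLocalKer (W.baseChange L) (w.adicCompletion L) n) :
    x ∈ selmerLocalKer W (v.adicCompletion F) n := by
  set H := (absGaloisRestrict F L).toMonoidHom.range with hHdef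
  set 𝔓 := 𝔔.comap (absIntegersMap F L) with h𝔓def
  have hwv : w.asIdeal.under (𝓞 F) = v.asIdeal :=
    (Ideal.LiesOver.over (P := w.asIdeal) (p := v.asIdeal)).symm
  have h𝔓 : 𝔓 ∈ v.primesAbove := comap_absIntegersMap_mem_primesAbove hwv h𝔔
  have hgoodL : (W.baseChange L).HasGoodReductionAt w :=
    hasGoodReductionAt_baseChange_of_hasGoodReductionAt W L v w hgood
  have hnL : (n : 𝓞 L) ∉ w.asIdeal := intCast_notMem_of_liesOver L v w hn
  -- both Selmer conditions are "unramified"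
  rw [W.selmerLocalKer_eq_unramifiedKer hgood hn h𝔓]
  rw [(W.baseChange L).selmerLocalKer_eq_unramifiedKer hgoodL hnL h𝔔] at hx
  obtain ⟨φ, rfl⟩ :=
    oneCocycleClass_surjective (discreteTopRep (absoluteGaloisGroup F) (geomTorsion W n)) x
  rw [unramifiedKer, oneCocycleClass_mem_subgroupResKer_iff]
  rw [resTorsion, resH1Hom_oneCocycleClass, unramifiedKer, oneCocycleClass_mem_subgroupResKer_iff]
    at hx
  obtain ⟨b, hb⟩ := hx
  -- inertia acts trivially on `E[n]`, downstairs and upstairs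
  have hI : ∀ σ ∈ 𝔓.inertia (absoluteGaloisGroup F), ∀ P : geomTorsion W n, σ • P = P :=
    fun σ hσ P ↦ W.smul_geomTorsion_eq_of_mem_inertia hgood hn h𝔓 hσ P
  -- (A) `φ (res τ) = 0` for `τ ∈ I_𝔔`
  have hA : ∀ τ ∈ 𝔔.inertia (absoluteGaloisGroup L), φ.1 (absGaloisRestrict F L τ) = 0 := by
    intro τ hτ
    have h := hb ⟨τ, hτ⟩
    rw [pullback_resHomOfEquivariant_apply] at h
    change torsionBaseChangeMap W L n (φ.1 (absGaloisRestrict F L τ)) = τ • b - b at h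
    rw [(W.baseChange L).smul_geomTorsion_eq_of_mem_inertia hgoodL hnL h𝔔 hτ b, sub_self] at h
    apply (torsionBaseChangeEquiv L W n).injective
    rw [(torsionBaseChangeEquiv L W n).map_zero, torsionBaseChangeEquiv_apply]
    exact h
  -- (B) `φ` vanishes on `I_𝔓 ∩ H`
  have hB : ∀ σ ∈ 𝔓.inertia (absoluteGaloisGroup F), σ ∈ H → φ.1 σ = 0 := by
    rintro σ hσ ⟨τ, rfl⟩
    have hτI : τ ∈ 𝔔.inertia (absoluteGaloisGroup L) := by
      rw [← comap_inertia_comap_absIntegersMap F L 𝔔, Subgroup.mem_comap]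
      exact hσ
    exact hA τ hτI
  -- (C) `φ` is a homomorphism on `I_𝔓 · Γ`: `φ (σ g) = φ σ + φ g` for `σ ∈ I_𝔓`
  have hC : ∀ σ ∈ 𝔓.inertia (absoluteGaloisGroup F), ∀ g, φ.1 (σ * g) = φ.1 σ + φ.1 g := by
    intro σ hσ g
    have h := φ.2 σ g
    rw [discreteTopRep_ρ_apply, hI σ hσ] at h
    exact h
  -- (D) `2 φ σ = 0` on `I_𝔓`
  have hD : ∀ σ ∈ 𝔓.inertia (absoluteGaloisGroup F), 2 • φ.1 σ = 0 := by
    intro σ hσ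
    have hsq : σ * σ ∈ H := by
      by_cases hσH : σ ∈ H
      · exact H.mul_mem hσH hσH
      · exact hmul σ σ hσH hσH
    have h := hB (σ * σ) ((𝔓.inertia _).mul_mem hσ hσ) hsq
    rw [hC σ hσ σ, ← two_nsmul] at h
    exact h
  -- (E) `φ (g σ g⁻¹) = g • φ σ` for `g ∈ Γ`, `σ ∈ I_𝔓` with `g σ g⁻¹ ∈ I_𝔓`
  have hE : ∀ g σ : absoluteGaloisGroup F, σ ∈ 𝔓.inertia (absoluteGaloisGroup F) →
      g * σ * g⁻¹ ∈ 𝔓.inertia (absoluteGaloisGroup F) → φ.1 (g * σ * g⁻¹) = g • φ.1 σ := by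
    intro g σ hσ hconjI
    -- `φ (g σ g⁻¹ · g) = φ (g σ g⁻¹) + φ g` and `= φ (g σ) = φ g + g • φ σ`
    have h1 := hC (g * σ * g⁻¹) hconjI g
    rw [inv_mul_cancel_right] at h1
    have h2 := φ.2 g σ
    rw [discreteTopRep_ρ_apply] at h2
    rw [h2] at h1
    -- `h1 : φ g + g • φ σ = φ (gσg⁻¹) + φ g`
    have := h1
    rw [add_comm (φ.1 (g * σ * g⁻¹))] at this
    exact (add_left_cancel this).symm
  -- (F) `g • φ σ = φ σ` for `g ∈ D_𝔓`, `σ ∈ I_𝔓`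
  have hF : ∀ σ ∈ 𝔓.inertia (absoluteGaloisGroup F),
      ∀ g ∈ 𝔓.decompositionSubgroup (absoluteGaloisGroup F), g • φ.1 σ = φ.1 σ := by
    intro σ hσ g hg
    have hconjI : g * σ * g⁻¹ ∈ 𝔓.inertia (absoluteGaloisGroup F) := conj_mem_inertia hg hσ
    rw [← hE g σ hσ hconjI]
    by_cases hσH : σ ∈ H
    · rw [hB σ hσ hσH, hB _ hconjI (hconj g σ hσH)]
    · -- `g σ g⁻¹ ∉ H`, `σ⁻¹ ∉ H`, so `(g σ g⁻¹) σ⁻¹ ∈ H ∩ I_𝔓`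
      have h1 : g * σ * g⁻¹ ∉ H := fun h ↦ hσH (by
        have h' := hconj g⁻¹ _ h
        rwa [inv_inv, ← mul_assoc, ← mul_assoc, inv_mul_cancel, one_mul, mul_assoc, inv_mul_cancel,
          mul_one] at h')
      have h2 : σ⁻¹ ∉ H := fun h ↦ hσH (by simpa using H.inv_mem h)
      have h3 : g * σ * g⁻¹ * σ⁻¹ ∈ H := hmul _ _ h1 h2
      have h4 : φ.1 (g * σ * g⁻¹ * σ⁻¹) = 0 :=
        hB _ ((𝔓.inertia _).mul_mem hconjI ((𝔓.inertia _).inv_mem hσ)) h3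
      rw [hC _ hconjI] at h4
      -- `φ σ⁻¹ = - φ σ`
      have h5 : φ.1 σ + φ.1 σ⁻¹ = 0 := by
        rw [← hC σ hσ σ⁻¹, mul_inv_cancel, contOneCocycles.apply_one]
      have h6 : φ.1 σ⁻¹ = -φ.1 σ := eq_neg_of_add_eq_zero_right h5
      rw [h6, ← sub_eq_add_neg, sub_eq_zero] at h4
      exact h4
  -- (G) conclude
  refine ⟨0, fun σ ↦ ?_⟩
  rw [smul_zero, sub_zero]
  exact hfix (φ.1 σ) (hD σ σ.2) (hF σ σ.2)

end General

/-! ## §2 Over `ℚ`: the quadratic field supplies the two group-theoretic hypotheses -/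

section Rat

variable {K : Type} [Field K] [NumberField K]

/-- **The quadratic criterion for `res Γ_K ≤ Γ_ℚ`** (`K = ℚ(θ)` quadratic, `θ ∉ ℚ`, `θ² = c ∈ ℤ`): for a suitable
embedding `e : K → ℚ̄`, `g ∈ res Γ_K ⟺ g` fixes `e(θ)`, and every `g ∈ Γ_ℚ` moves `e(θ)` to `± e(θ)`.
(`exists_mem_range_absGaloisRestrict_iff`: `res Γ_K` is the pointwise fixer of `e(K) = ℚ(e θ)`.) [folklore] -/
theorem exists_embed_range_absGaloisRestrict_iff (h2 : Module.finrank ℚ K = 2) {θ : K}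
    (hθ : θ ∉ (algebraMap ℚ K).range) {c : ℤ} (hc : θ ^ 2 = algebraMap ℚ K c) :
    ∃ e : @AlgHom ℚ K (AlgebraicClosure ℚ) _ _ _ _ (AlgebraicClosure.instAlgebra ℚ),
      (∀ g : absoluteGaloisGroup ℚ, g ∈ (absGaloisRestrict ℚ K).toMonoidHom.range ↔ g • e θ = e θ) ∧
        ∀ g : absoluteGaloisGroup ℚ, g • e θ = e θ ∨ g • e θ = -e θ := by
  haveI : Algebra.IsAlgebraic ℚ K := Algebra.IsAlgebraic.of_finite ℚ K
  obtain ⟨e, he⟩ := exists_mem_range_absGaloisRestrict_iff ℚ K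
  refine ⟨e, fun g ↦ ⟨fun hg ↦ (he g).mp hg θ, fun hg ↦ (he g).mpr ?_⟩, fun g ↦ ?_⟩
  · -- the subalgebra of elements of `K` whose image is fixed by `g` contains `θ`, hence is `K`
    let A : Subalgebra ℚ K :=
      { carrier := {x | g • e x = e x}
        mul_mem' := fun {a b} ha hb => by
          change g • e (a * b) = e (a * b)
          rw [map_mul, smul_mul', ha, hb]
        one_mem' := by
          change g • e 1 = e 1
          rw [map_one, smul_one]
        add_mem' := fun {a b} ha hb => by
          change g • e (a + b) = e (a + b)
          rw [map_add, smul_add, ha, hb]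
        zero_mem' := by
          change g • e 0 = e 0
          rw [map_zero, smul_zero]
        algebraMap_mem' := fun q => by
          change g • e (algebraMap ℚ K q) = e (algebraMap ℚ K q)
          rw [AlgHom.commutes, absoluteGaloisGroup.smul_def]
          exact AlgEquiv.commutes _ q }
    have hθA : θ ∈ A := hg
    have hA : A = ⊤ :=
      top_le_iff.mp ((adjoin_simple_eq_top_of_finrank_eq_two h2 hθ).symm.le.trans
        (Algebra.adjoin_le (Set.singleton_subset_iff.mpr hθA)))
    intro x
    have hx : x ∈ A := by rw [hA]; exact Algebra.mem_top
    exact hx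
  · have hsq : (g • e θ) ^ 2 = (e θ) ^ 2 := by
      rw [← smul_pow', ← map_pow, hc, AlgHom.commutes, absoluteGaloisGroup.smul_def]
      exact AlgEquiv.commutes _ _
    exact sq_eq_sq_iff_eq_or_eq_neg.mp hsq

/-- **`res Γ_K` has "index ≤ 2"**: a product of two elements of `Γ_ℚ` outside `res Γ_K` lies in it (both move
`e(θ)` to `−e(θ)`). [folklore] -/
theorem mul_mem_range_absGaloisRestrict_of_not_mem (h2 : Module.finrank ℚ K = 2) {θ : K}
    (hθ : θ ∉ (algebraMap ℚ K).range) {c : ℤ} (hc : θ ^ 2 = algebraMap ℚ K c) (a b : absoluteGaloisGroup ℚ)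
    (ha : a ∉ (absGaloisRestrict ℚ K).toMonoidHom.range) (hb : b ∉ (absGaloisRestrict ℚ K).toMonoidHom.range) :
    a * b ∈ (absGaloisRestrict ℚ K).toMonoidHom.range := by
  obtain ⟨e, hcrit, hroot⟩ := exists_embed_range_absGaloisRestrict_iff h2 hθ hc
  rw [hcrit] at ha hb ⊢
  have ha' : a • e θ = -e θ := (hroot a).resolve_left ha
  have hb' : b • e θ = -e θ := (hroot b).resolve_left hb
  rw [mul_smul, hb', smul_neg, ha', neg_neg]

/-- **`res Γ_K` is normal in `Γ_ℚ`** (`K/ℚ` is Galois): `g h g⁻¹ ∈ res Γ_K` for `h ∈ res Γ_K`. [folklore] -/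
theorem conj_mem_range_absGaloisRestrict (h2 : Module.finrank ℚ K = 2) {θ : K}
    (hθ : θ ∉ (algebraMap ℚ K).range) {c : ℤ} (hc : θ ^ 2 = algebraMap ℚ K c) (g h : absoluteGaloisGroup ℚ)
    (hh : h ∈ (absGaloisRestrict ℚ K).toMonoidHom.range) :
    g * h * g⁻¹ ∈ (absGaloisRestrict ℚ K).toMonoidHom.range := by
  obtain ⟨e, hcrit, hroot⟩ := exists_embed_range_absGaloisRestrict_iff h2 hθ hc
  rw [hcrit] at hh ⊢
  rw [mul_smul, mul_smul]
  rcases hroot g⁻¹ with hi | hi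
  · rw [hi, hh]
    nth_rw 1 [← hi]
    rw [smul_inv_smul]
  · rw [hi, smul_neg, hh, ← hi, smul_inv_smul]

variable (W : WeierstrassCurve ℚ) [W.IsElliptic]

/-- **McCallum's Lemma 4.3 transported from `K = ℚ(√c)` to `ℚ` at ANY odd-or-even good place `v ∤ n`, in particular
at the RAMIFIED primes `v ∣ c`, away from `D_𝔓`-fixed `2`-torsion.** `K = ℚ(θ)` quadratic (`θ ∉ ℚ`, `θ² = c ∈ ℤ`),
`E = W/ℚ` elliptic, `n : ℤ`, `v` of good reduction with `v ∤ n`, `w ∣ v`, `𝔔 ∣ w`; if no non-zero `T ∈ E[n]` with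
`2T = 0` is fixed by the decomposition group of `𝔓 = 𝔔 ∩ \bar ℤ` (over `ℚ`: `E(ℚ_v)[2] = 0`, `Frob_v` a `3`-cycle on
`E[2]` — the DEF-free primes), then `res x ∈ selmerLocalKer_w(E_K) ⟹ x ∈ selmerLocalKer_v(E)`. For the pair descent
of LINE 6 (`c = d_K`, `n = 2^M`): Lemma 4.3 over `ℚ` for the member `E` at the DEF-free primes of `d_K` follows from
Lemma 4.3 over `K`. [cite: McCallumLMS1991, §4 Lemma 4.3] [cite: Kolyvagin1989Izv, §3] -/
theorem mem_selmerLocalKer_of_resTorsion_mem_quadratic_of_fixed_two_torsion_eq_zero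
    (h2 : Module.finrank ℚ K = 2) {θ : K} (hθ : θ ∉ (algebraMap ℚ K).range) {c : ℤ}
    (hc : θ ^ 2 = algebraMap ℚ K c) (n : ℤ) (v : HeightOneSpectrum (𝓞 ℚ)) (w : HeightOneSpectrum (𝓞 K))
    [w.asIdeal.LiesOver v.asIdeal] (hgood : W.HasGoodReductionAt v) (hn : (n : 𝓞 ℚ) ∉ v.asIdeal)
    {𝔔 : Ideal (absIntegers (𝓞 K) K)} (h𝔔 : 𝔔 ∈ w.primesAbove)
    (hfix : ∀ T : geomTorsion W n, 2 • T = 0 →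
      (∀ g ∈ (𝔔.comap (absIntegersMap ℚ K)).decompositionSubgroup (absoluteGaloisGroup ℚ), g • T = T) →
        T = 0)
    {x : galH1Torsion W n} (hx : resTorsion W K n x ∈ selmerLocalKer (W.baseChange K) (w.adicCompletion K) n) :
    x ∈ selmerLocalKer W (v.adicCompletion ℚ) n :=
  mem_selmerLocalKer_of_resTorsion_mem_of_fixed_two_torsion_eq_zero W K v w n hgood hn h𝔔
    (mul_mem_range_absGaloisRestrict_of_not_mem h2 hθ hc) (conj_mem_range_absGaloisRestrict h2 hθ hc) hfix hx

end Rat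

end Summit.BirchSwinnertonDyer.BirchSwinnertonDyer.Theorems.GenusExact.SelmerDescent

end
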